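import Summits.QuantumFields.YangMills.Theorems.WeakCouplingRatesBulkDominatesColdBoxWStubKernelMeanExpansion
import Summits.QuantumFields.YangMills.Theorems.BalabanLadderUVSeamRecColdWallKernelMeanPolyWindowCrux
import Summits.QuantumFields.YangMills.Theorems.BalabanLadderNTBoundaryLawSymmetry
import Summits.QuantumFields.YangMills.Theorems.BalabanLadderUVSeamRecClassicalResponseDefs
import HarnessLib

/-!
# Crux `UVSeamRec` (stmt-QuantumFields-20043), line «coldwall_pure», stub `stub_coldWallSplit` (CW): THE NEAR-FLAT CORNER —
# two CRUDE-GOOD exteriors have the same centre kernel mean up to `o(R⁻⁴)` at the top of the polynomial window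

Helper file (`--supports stmt-QuantumFields-20043`) of the LEAD seat `ym-spine-20043-p1` (gen 15).  The registered hardest stub (CW) of
`Lines/coldwall_pure.lean` asks, for EVERY exterior `η` on the femto window, `(R⁴/C₁)|kerE^η(plane q x) − kerE^𝟙(plane q x)| ≤ A₂ + carrierCl rF C_s 1 β R q x η`
(«quantum response ≤ A₂ + β·R⁴ × classical response, relative to the cold wall»).  Gens 11–14 settled the IDENTITY exterior on the polynomial window.
This file is the first (CW)-type theorem of the line with a NON-identity exterior: on the TOP SCALE `R + 1 = ⌈β^θ⌉` of the polynomial window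
(`0 < θ ≤ θ₀ ≤ 1/100`, `θ₀` the route `WeakCouplingRates`' exponent of `stub_kernelMeanExpansion`), for exteriors all of whose plaquettes based in the
corona range of the cube have deficit `≤ β^{2θ/5 − 1}` («crude-good», the route's `CrudeGood`), the centre kernel mean agrees with the cold-wall one to
`o(R⁻⁴)` — (CW) holds there WITHOUT the carrier:
* §1 (route letters) `crudeGood_relabel_edgePerm` (crude-goodness is hypercubic-invariant); **`kernelMean_sub_kernelMean_le_of_crudeGood`**: for two
  crude-good data `ω, ω'` of the box `H = ⌈β^θ⌉` and base points within `H/8` of the centre,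
  `|E_{γ_H(·|ω)}[c_{x;1,2}] − E_{γ_H(·|ω')}[c_{x;1,2}]| ≤ 16(2H+3)⁴β^{2θ/5−1} + 2β^{−1−θ}` — the route's REGISTERED THEOREM `stub_kernelMeanExpansion`
  (one-scale expansion WITH background, `β·E_ω[c_x] = (3/2)V_D(x) + β·Σ_c F̄_c(x)² ± β^{−θ}`) for both data, the datum-free Gaussian term cancelling,
  and the ENERGY bound of the harmonic background `sum_dirBackground_sq_le_formM` (`Σ_c F̄_c(x)² ≤ Σ_c M_{ϑ_c}(s_c) ≤ 16(2H+3)⁴β^{2δ−1}`): the classical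
  term of a crude-good datum is below the stub's resolution `R⁻⁴` on the polynomial window (`16R⁴(2H+3)⁴β^{2δ−1} ≤ 16·7⁸β^{8.4θ−1} → 0`);
* §2 (crux letters) dictionary for a general exterior (`kerE_eq_integral_boxKernel`, `kerE_plane_eq_origin_perm` via the translation and hypercubic
  covariance of the cube kernels `kerE_plane_configShift` ∕ `kerE_plane_perm`, `crudeGood_configShift_of_coronaGood`);
* §3 **`kerE_sub_kerE_le_of_coronaGood_polyTop`** (two corona-good exteriors: `R⁴·|kerE^η(plane q x) − kerE^{η'}(plane q x)| ≤ β^{−1/2}`, all planes,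
  all sites, `R + 1 = ⌈β^θ⌉`), **`coldWallSplit_coronaGood_polyTop`** (`η' = 𝟙`), `coldWallSplit_inequality_coronaGood_polyTop` (the literal (CW)
  inequality with ANY constants `C_s, C₁, A₂ > 0`, eventually in `β`; the carrier enters only through `carrierCl ≥ 0`).
HONEST FRAMING: the near-flat corner of (CW) at ONE scale of the polynomial window; exteriors with a corona plaquette of deficit `> β^{2θ/5−1}` (where the
carrier must pay), the rest of the polynomial window (`H`-uniformity of the datum package) and the femto window are untouched; nothing of E0′, NT or the
gap; YM mass gap NOT proved; not Clay.
-/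

set_option autoImplicit false

noncomputable section

open MeasureTheory Finset Filter
open Literature.Probability.LatticeModels (Site)
open Literature.MathematicalPhysics.QuantumLattice
open Literature.MathematicalPhysics.QuantumFieldTheory
open Literature.MathematicalPhysics.QuantumFieldTheory.LatticeMaxwell
open Literature.MathematicalPhysics.QuantumFieldTheory.AxialGauge
open Summit.QuantumFields.YangMills.Theorems.WeakCouplingRates
open Summit.QuantumFields.YangMills.Cruxes.OSLegsFromFemtoAndGap.DlrCollarTransfer (cubeSites cubeEdges kerE plane)
open Summit.QuantumFields.YangMills.Cruxes.NT.BoundaryLaw (plane_configShift kerE_plane_perm kerE_plane_configShift configShift_configShift)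

namespace Summit.QuantumFields.YangMills.Cruxes.UVSeamRec.ClassicalResponse.ColdWall

/-! ### §1 Route letters: crude-goodness is hypercubic-invariant; two crude-good data have close kernel means -/

/-- The plaquette cost is symmetric in the two directions of the plane (`U_{x;j,i} = U_{x;i,j}⁻¹` and `Re tr ρ(g⁻¹) = Re tr ρ(g)` for the
unitary fundamental representation). [folklore] -/
theorem plaqCostAt_swap (x : Site 4) (i j : Fin 4) (U : LGConfig 4 (Matrix.specialUnitaryGroup (Fin 2) ℂ)) :
    plaqCostAt (fundamentalRep (Fin 2)) x j i U = plaqCostAt (fundamentalRep (Fin 2)) x i j U := by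
  unfold plaqCostAt plaquetteObs
  rw [Literature.MathematicalPhysics.QuantumLattice.plaquetteHolonomyZd_swap, Literature.RepresentationTheory.CompactGroups.CompactGroup.re_trace_map_inv _ (continuous_fundamentalRep (Fin 2))]

/-- The plaquette cost of the relabelled configuration at the relabelled plaquette is the original one. [folklore] -/
theorem plaqCostAt_relabel_edgePerm (σ : Equiv.Perm (Fin 4)) (y : Site 4) (i j : Fin 4)
    (U : LGConfig 4 (Matrix.specialUnitaryGroup (Fin 2) ℂ)) :
    plaqCostAt (fundamentalRep (Fin 2)) (Literature.MathematicalPhysics.QuantumLattice.sitePerm σ y) (σ i) (σ j) (relabelConfig (edgePerm σ) U) =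
      plaqCostAt (fundamentalRep (Fin 2)) y i j U := by
  unfold plaqCostAt plaquetteObs
  rw [plaquetteHolonomyZd_relabel_edgePerm]

/-- **Crude-goodness is invariant under coordinate permutations** (the corona range `[−1, 2H+1]⁴` and the set of plaquette costs are
hypercubic-invariant). [folklore] -/
theorem crudeGood_relabel_edgePerm {β δ : ℝ} {H : ℕ} (σ : Equiv.Perm (Fin 4)) {ω : LGConfig 4 (Matrix.specialUnitaryGroup (Fin 2) ℂ)}
    (hω : CrudeGood β δ H ω) : CrudeGood β δ H (relabelConfig (edgePerm σ) ω) := by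
  intro x hx i j hij
  -- pull the plaquette back along `σ`
  set y : Site 4 := Literature.MathematicalPhysics.QuantumLattice.sitePerm σ.symm x with hy
  have hxy : Literature.MathematicalPhysics.QuantumLattice.sitePerm σ y = x := by
    rw [hy, ← Literature.MathematicalPhysics.QuantumLattice.sitePerm_symm]; exact (Literature.MathematicalPhysics.QuantumLattice.sitePerm σ).apply_symm_apply x
  have hi : σ (σ.symm i) = i := σ.apply_symm_apply i
  have hj : σ (σ.symm j) = j := σ.apply_symm_apply j
  have hyr : ∀ k : Fin 4, (-1 : ℤ) ≤ y k ∧ y k ≤ 2 * (H : ℤ) + 1 := fun k => by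
    rw [hy, Literature.MathematicalPhysics.QuantumLattice.sitePerm_apply]; exact hx _
  have hne : σ.symm i ≠ σ.symm j := fun h => (ne_of_lt hij) (σ.symm.injective h)
  rw [← hxy, ← hi, ← hj, plaqCostAt_relabel_edgePerm]
  rcases lt_or_gt_of_ne hne with h | h
  · exact hω y hyr _ _ h
  · rw [← plaqCostAt_swap]; exact hω y hyr _ _ h

/-- The background energy bound at one plaquette touching the box: `Σ_c F̄_c(q)² ≤ Σ_c M_{ϑ_c}(s_c)` (the background has the minimal energy
`K_ϑ ≤ M_ϑ(s)`, `sum_dirBackground_sq_le_formM`, and `F̄(q)²` is one term of it). [folklore] -/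
theorem sum_dirBackground_sq_at_le_sum_formM (H : ℕ) (ϑ : Fin 3 → Literature.MathematicalPhysics.QuantumLattice.ZdEdge 4 → ℝ)
    (s : Fin 3 → DirFree H → ℝ) {x : Site 4} {i j : Fin 4} (hij : i < j)
    (hxt : ((x, ⟨(i, j), hij⟩) : ZdPlaquette 4) ∈ plaquettesTouching (boxEdges 4 (2 * H + 1))) :
    ∑ c, (sCirc (glue (pin := fun e => e ∉ dirFreeEdges H) dirCorner (2 * H + 3) (ϑ c)
        (mean (fun e => e ∉ dirFreeEdges H) dirCorner (2 * H + 3) (ϑ c))) (x, i, j)) ^ 2 ≤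
      ∑ c, formM (fun e => e ∉ dirFreeEdges H) dirCorner (2 * H + 3) (ϑ c) (s c) := by
  refine Finset.sum_le_sum fun c _ => ?_
  have hq := unshift_mem_plaquettesIn hxt
  have hs : Plaq.shift dirCorner ((x - dirCorner, i, j) : Plaq 4) = (x, i, j) := by simp [Plaq.shift]
  have h1 := sum_dirBackground_sq_le_formM H (ϑ c) (s c)
  refine le_trans ?_ h1
  have h2 := Finset.single_le_sum (f := fun p : Plaq 4 => sCirc (glue (pin := fun e => e ∉ dirFreeEdges H) dirCorner (2 * H + 3) (ϑ c)
        (mean (fun e => e ∉ dirFreeEdges H) dirCorner (2 * H + 3) (ϑ c))) (Plaq.shift dirCorner p) ^ 2)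
    (fun p _ => sq_nonneg _) hq
  simpa only [hs] using h2

/-- **TWO CRUDE-GOOD DATA HAVE CLOSE KERNEL MEANS (route letters).**  There is `θ₀ ∈ (0, 1/100]` such that for all `0 < θ ≤ θ₀`, eventually in
`β`, with `H = ⌈β^θ⌉`: for all data `ω, ω'` crude-good at scale `β^{2θ/5−1}` and every base point `x` within `H/8` of the centre,
`|E_{γ_H(·|ω)}[c_{x;1,2}] − E_{γ_H(·|ω')}[c_{x;1,2}]| ≤ 16(2H+3)⁴β^{2θ/5−1} + 2β^{−1−θ}` — the route `WeakCouplingRates`' one-scale expansion with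
background (`stub_kernelMeanExpansion`) for both data, the datum-free Gaussian term cancelling, the two background terms bounded by the energy clause. [folklore] -/
theorem kernelMean_sub_kernelMean_le_of_crudeGood :
    ∃ θ₀ : ℝ, 0 < θ₀ ∧ θ₀ ≤ 1 / 100 ∧ ∀ θ : ℝ, 0 < θ → θ ≤ θ₀ → ∃ β₀ : ℝ, ∀ β : ℝ, β₀ ≤ β →
      ∀ ω ω' : LGConfig 4 (Matrix.specialUnitaryGroup (Fin 2) ℂ),
        CrudeGood β (θ / 5) ⌈β ^ θ⌉₊ ω → CrudeGood β (θ / 5) ⌈β ^ θ⌉₊ ω' →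
        ∀ x : Site 4, (∀ m : Fin 4, 8 * |x m - (⌈β ^ θ⌉₊ : ℤ)| ≤ (⌈β ^ θ⌉₊ : ℤ)) →
          |(∫ U, plaqCostAt (fundamentalRep (Fin 2)) x 1 2 U ∂(boxKernel β ⌈β ^ θ⌉₊ ω)) -
              (∫ U, plaqCostAt (fundamentalRep (Fin 2)) x 1 2 U ∂(boxKernel β ⌈β ^ θ⌉₊ ω'))| ≤
            16 * (2 * (⌈β ^ θ⌉₊ : ℝ) + 3) ^ 4 * β ^ (2 * (θ / 5) - 1) + 2 * β ^ (-1 - θ) := by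
  obtain ⟨θ₂, hθ₂, hK⟩ := stub_kernelMeanExpansion
  refine ⟨min θ₂ (1 / 100), lt_min hθ₂ (by norm_num), min_le_right _ _, fun θ hθ hθle => ?_⟩
  obtain ⟨β₀, hKME⟩ := hK θ hθ (hθle.trans (min_le_left _ _))
  refine ⟨max β₀ 1, fun β hβ ω ω' hω hω' x hx => ?_⟩
  have hb0 : β₀ ≤ β := (le_max_left _ _).trans hβ
  have hβ1 : (1 : ℝ) ≤ β := (le_max_right _ _).trans hβ; have hβ0 : 0 < β := by linarith
  set H : ℕ := ⌈β ^ θ⌉₊ with hHdef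
  have hH : 1 ≤ H := by have h := (one_le_ceil_rpow_and_le hβ1 hθ.le).1; rw [← hHdef] at h; exact_mod_cast h
  have hxt := near_centre_mem_plaquettesTouching hH hx
  obtain ⟨ϑ, s, hE, hexp⟩ := hKME β hb0 ω hω
  obtain ⟨ϑ', s', hE', hexp'⟩ := hKME β hb0 ω' hω'
  have h1 := hexp x hx
  have h2 := hexp' x hx
  set M : ℝ := 16 * (2 * (H : ℝ) + 3) ^ 4 * β ^ (2 * (θ / 5) - 1) with hM
  have hB := (sum_dirBackground_sq_at_le_sum_formM H ϑ s (show (1 : Fin 4) < 2 by decide) hxt).trans hE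
  have hB' := (sum_dirBackground_sq_at_le_sum_formM H ϑ' s' (show (1 : Fin 4) < 2 by decide) hxt).trans hE'
  generalize hBdef : ∑ c, (sCirc (glue (pin := fun e => e ∉ dirFreeEdges H) dirCorner (2 * H + 3) (ϑ c)
        (mean (fun e => e ∉ dirFreeEdges H) dirCorner (2 * H + 3) (ϑ c))) (x, 1, 2)) ^ 2 = B at h1 hB
  generalize hB'def : ∑ c, (sCirc (glue (pin := fun e => e ∉ dirFreeEdges H) dirCorner (2 * H + 3) (ϑ' c)
        (mean (fun e => e ∉ dirFreeEdges H) dirCorner (2 * H + 3) (ϑ' c))) (x, 1, 2)) ^ 2 = B' at h2 hB'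
  have hB0 : 0 ≤ B := by rw [← hBdef]; exact Finset.sum_nonneg fun c _ => sq_nonneg _
  have hB'0 : 0 ≤ B' := by rw [← hB'def]; exact Finset.sum_nonneg fun c _ => sq_nonneg _
  generalize hVdef : boxDirProjKernel H (x, 1, 2) (x, 1, 2) = V at h1 h2
  generalize hIdef : ∫ U, plaqCostAt (fundamentalRep (Fin 2)) x 1 2 U ∂(boxKernel β H ω) = I at h1 ⊢
  generalize hI'def : ∫ U, plaqCostAt (fundamentalRep (Fin 2)) x 1 2 U ∂(boxKernel β H ω') = I' at h2 ⊢
  have hkey : β * |I - I'| ≤ 2 * β ^ (-θ) + β * M := by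
    rw [← abs_of_pos hβ0, ← abs_mul, abs_of_pos hβ0, mul_sub]
    have hd : |β * B - β * B'| ≤ β * M := by
      rw [← mul_sub, abs_mul, abs_of_pos hβ0]
      exact mul_le_mul_of_nonneg_left (abs_sub_le_of_nonneg_of_le hB0 hB hB'0 hB') hβ0.le
    calc |β * I - β * I'| = |(β * I - 3 / 2 * V - β * B) - (β * I' - 3 / 2 * V - β * B') + (β * B - β * B')| := by ring_nf
      _ ≤ |(β * I - 3 / 2 * V - β * B) - (β * I' - 3 / 2 * V - β * B')| + |β * B - β * B'| := abs_add_le _ _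
      _ ≤ (|β * I - 3 / 2 * V - β * B| + |β * I' - 3 / 2 * V - β * B'|) + β * M := add_le_add (abs_sub _ _) hd
      _ ≤ (β ^ (-θ) + β ^ (-θ)) + β * M := by gcongr
      _ = 2 * β ^ (-θ) + β * M := by ring
  have hβθ : β ^ (-1 - θ) = β ^ (-θ) / β := by rw [show -1 - θ = -θ - 1 by ring, Real.rpow_sub_one hβ0.ne']
  rw [hβθ, show M + 2 * (β ^ (-θ) / β) = (2 * β ^ (-θ) + β * M) / β by field_simp; ring, le_div_iff₀ hβ0, mul_comm]
  exact hkey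

/-! ### §2 Crux letters: cubes `(x − R − 1, 2R + 3)`, all planes, two corona-good exteriors -/

/-- **Dictionary for a general exterior.**  The crux's kernel of the cube `(0, 2R+3)` with exterior `η` is integration against the route's box
kernel `boxKernel β (R+1) η` (fundamental `SU(2)`). [folklore] -/
theorem kerE_eq_integral_boxKernel (β : ℝ) (R : ℕ) (η : LGConfig 4 (Matrix.specialUnitaryGroup (Fin 2) ℂ))
    (F : LGConfig 4 (Matrix.specialUnitaryGroup (Fin 2) ℂ) → ℝ) :
    kerE (Matrix.specialUnitaryGroup (Fin 2) ℂ) (fundamentalLatticeRep 2) β 0 (2 * R + 3) η F = ∫ U, F U ∂(boxKernel β (R + 1) η) := by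
  unfold kerE boxKernel; rw [cubeEdges_zero, show 2 * (R + 1) + 1 = 2 * R + 3 by ring]; rfl

/-- The kernel mean of the `(1,2)`-plane field at the centre of the cube `(0, 2R+3)` is `2 −` the route's kernel mean of the plaquette cost at the
centre of the box `[0, 2(R+1)]⁴`. [folklore] -/
theorem kerE_plane_centre_eq (β : ℝ) (R : ℕ) (η : LGConfig 4 (Matrix.specialUnitaryGroup (Fin 2) ℂ)) :
    kerE (Matrix.specialUnitaryGroup (Fin 2) ℂ) (fundamentalLatticeRep 2) β 0 (2 * R + 3) η
        (plane (Matrix.specialUnitaryGroup (Fin 2) ℂ) (fundamentalLatticeRep 2) (1, 2) (fun _ => (R : ℤ) + 1)) =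
      2 - ∫ U, plaqCostAt (fundamentalRep (Fin 2)) (fun _ => (R : ℤ) + 1) 1 2 U ∂(boxKernel β (R + 1) η) := by
  haveI := isProbabilityMeasure_boxKernel β (R + 1) η
  rw [kerE_eq_integral_boxKernel]
  have hF : (plane (Matrix.specialUnitaryGroup (Fin 2) ℂ) (fundamentalLatticeRep 2) (1, 2) (fun _ => (R : ℤ) + 1)) =
      fun U => 2 - plaqCostAt (fundamentalRep (Fin 2)) (fun _ => (R : ℤ) + 1) 1 2 U := by
    funext U
    have h := two_sub_plane_eq_plaqCostAt (1, 2) (fun _ => (R : ℤ) + 1) U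
    linarith
  rw [hF, integral_sub (integrable_const _) (integrable_of_bound (measurable_plaqCostAt _ _ _).aestronglyMeasurable
    (abs_plaqCostAt_le _ _ _)), integral_const]
  simp

/-- A coordinate permutation of `Fin 4` taking `1 ↦ i`, `2 ↦ j` (`i ≠ j`): two transpositions. [folklore] -/
theorem exists_perm_one_two {i j : Fin 4} (hij : i ≠ j) : ∃ σ : Equiv.Perm (Fin 4), σ 1 = i ∧ σ 2 = j := by
  have hk : Equiv.swap (1 : Fin 4) i 2 ≠ i := by
    intro hk
    have h12 : (Equiv.swap (1 : Fin 4) i) 2 = Equiv.swap (1 : Fin 4) i 1 := by rw [hk, Equiv.swap_apply_left]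
    exact absurd ((Equiv.swap (1 : Fin 4) i).injective h12) (by decide)
  refine ⟨(Equiv.swap 1 i).trans (Equiv.swap (Equiv.swap 1 i 2) j), ?_, ?_⟩
  · rw [Equiv.trans_apply, Equiv.swap_apply_left, Equiv.swap_apply_of_ne_of_ne hk.symm hij]
  · rw [Equiv.trans_apply, Equiv.swap_apply_left]

/-- **Moving a cube kernel mean to the origin and to the `(1,2)`-plane.**  For a coordinate permutation `σ` with `σ 1 = q.1`, `σ 2 = q.2`: the
kernel mean of `plane q x` in the cube `(x − R − 1, 2R + 3)` with exterior `η` is that of the `(1,2)`-field at the centre of the cube `(0, 2R+3)` with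
`η` translated back by `x − (R+1)·𝟙` and relabelled along `σ⁻¹` (covariance of the cube kernels, `kerE_plane_configShift`, `kerE_plane_perm`). [folklore] -/
theorem kerE_plane_eq_origin_perm (β : ℝ) (R : ℕ) (q : Fin 4 × Fin 4) (x : Fin 4 → ℤ) (η : LGConfig 4 (Matrix.specialUnitaryGroup (Fin 2) ℂ))
    (σ : Equiv.Perm (Fin 4)) (h1 : σ 1 = q.1) (h2 : σ 2 = q.2) :
    kerE (Matrix.specialUnitaryGroup (Fin 2) ℂ) (fundamentalLatticeRep 2) β (fun k => x k - (R + 1)) (2 * R + 3) η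
        (plane (Matrix.specialUnitaryGroup (Fin 2) ℂ) (fundamentalLatticeRep 2) q x) =
      kerE (Matrix.specialUnitaryGroup (Fin 2) ℂ) (fundamentalLatticeRep 2) β 0 (2 * R + 3)
        ((relabelConfig (edgePerm σ)).symm (configShift (fun k => ((R : ℤ) + 1) - x k) η))
        (plane (Matrix.specialUnitaryGroup (Fin 2) ℂ) (fundamentalLatticeRep 2) (1, 2) (fun _ => (R : ℤ) + 1)) := by
  -- translation to the origin
  set v : Fin 4 → ℤ := fun k => x k - ((R : ℤ) + 1) with hv
  set η₀ : LGConfig 4 (Matrix.specialUnitaryGroup (Fin 2) ℂ) := configShift (fun k => ((R : ℤ) + 1) - x k) η with hη₀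
  have hηv : configShift v η₀ = η := by
    rw [hη₀, configShift_configShift]
    have h0 : (v + fun k => ((R : ℤ) + 1) - x k) = 0 := by funext k; simp [hv]
    rw [h0]; funext e; simp
  have hxv : ((fun _ : Fin 4 => (R : ℤ) + 1) + v) = x := by funext k; simp [hv]
  have hT : kerE (Matrix.specialUnitaryGroup (Fin 2) ℂ) (fundamentalLatticeRep 2) β (fun k => x k - (R + 1)) (2 * R + 3) η
        (plane (Matrix.specialUnitaryGroup (Fin 2) ℂ) (fundamentalLatticeRep 2) q x) =
      kerE (Matrix.specialUnitaryGroup (Fin 2) ℂ) (fundamentalLatticeRep 2) β 0 (2 * R + 3) η₀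
        (plane (Matrix.specialUnitaryGroup (Fin 2) ℂ) (fundamentalLatticeRep 2) q (fun _ => (R : ℤ) + 1)) := by
    have h := kerE_plane_configShift (Matrix.specialUnitaryGroup (Fin 2) ℂ) (fundamentalLatticeRep 2) v β 0 (2 * R + 3) η₀ q
      (fun _ => (R : ℤ) + 1)
    rw [zero_add, hηv, hxv] at h
    exact h
  -- permutation to the `(1,2)`-plane
  set η₁ : LGConfig 4 (Matrix.specialUnitaryGroup (Fin 2) ℂ) := (relabelConfig (edgePerm σ)).symm η₀ with hη₁
  have hησ : relabelConfig (edgePerm σ) η₁ = η₀ := (relabelConfig (edgePerm σ)).apply_symm_apply η₀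
  have hc : Literature.MathematicalPhysics.QuantumLattice.sitePerm σ (0 : Fin 4 → ℤ) = 0 := by funext k; simp
  have hy : Literature.MathematicalPhysics.QuantumLattice.sitePerm σ (fun _ : Fin 4 => (R : ℤ) + 1) = fun _ => (R : ℤ) + 1 := by
    funext k; simp
  have hq : q = (σ ((1 : Fin 4), (2 : Fin 4)).1, σ ((1 : Fin 4), (2 : Fin 4)).2) := by rw [h1, h2]
  have hP := kerE_plane_perm (Matrix.specialUnitaryGroup (Fin 2) ℂ) (fundamentalLatticeRep 2) σ β 0 (2 * R + 3) η₁ (1, 2)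
    (fun _ => (R : ℤ) + 1)
  rw [hc, hy, hησ, ← hq] at hP
  rw [hT, ← hP]

/-- `(relabelConfig (edgePerm σ))⁻¹ = relabelConfig (edgePerm σ⁻¹)` on configurations. [folklore] -/
theorem relabelConfig_edgePerm_symm_apply (σ : Equiv.Perm (Fin 4)) (η : LGConfig 4 (Matrix.specialUnitaryGroup (Fin 2) ℂ)) :
    (relabelConfig (edgePerm σ)).symm η = relabelConfig (edgePerm σ.symm) η := by
  funext e
  rw [relabelConfig_symm_apply, relabelConfig_apply]
  congr 1

/-- **Corona-goodness in the crux's letters is the route's crude-goodness of the exterior moved to the origin.**  If every plaquette of `η` based in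
the corona range `[x − R − 2, x + R + 2]⁴` of the cube `(x − R − 1, 2R + 3)` has deficit `2 − plane ≤ β^{2δ−1}`, then the translate
`configShift ((R+1)·𝟙 − x) η` (the cube moved to `[0, 2R+2]⁴`) is `CrudeGood β δ (R+1)`. [folklore] -/
theorem crudeGood_configShift_of_coronaGood {β δ : ℝ} {R : ℕ} {x : Fin 4 → ℤ} {η : LGConfig 4 (Matrix.specialUnitaryGroup (Fin 2) ℂ)}
    (hη : ∀ y : Fin 4 → ℤ, (∀ k : Fin 4, x k - R - 2 ≤ y k ∧ y k ≤ x k + R + 2) → ∀ i j : Fin 4, i < j →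
      2 - plane (Matrix.specialUnitaryGroup (Fin 2) ℂ) (fundamentalLatticeRep 2) (i, j) y η ≤ β ^ (2 * δ - 1)) :
    CrudeGood β δ (R + 1) (configShift (fun k => ((R : ℤ) + 1) - x k) η) := by
  intro y hy i j hij
  set v : Fin 4 → ℤ := fun k => ((R : ℤ) + 1) - x k with hv
  have hyv : (y - v) + v = y := sub_add_cancel y v
  rw [← two_sub_plane_eq_plaqCostAt (i, j) y, ← hyv, plane_configShift]
  refine hη (y - v) (fun k => ?_) i j hij
  have := hy k
  simp only [Pi.sub_apply, hv]
  push_cast at this ⊢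
  constructor <;> omega

/-- The identity exterior is corona-good (all its plaquette costs vanish). [folklore] -/
theorem coronaGood_one {β δ : ℝ} (hβ : 0 ≤ β) (R : ℕ) (x : Fin 4 → ℤ) :
    ∀ y : Fin 4 → ℤ, (∀ k : Fin 4, x k - R - 2 ≤ y k ∧ y k ≤ x k + R + 2) → ∀ i j : Fin 4, i < j →
      2 - plane (Matrix.specialUnitaryGroup (Fin 2) ℂ) (fundamentalLatticeRep 2) (i, j) y
        (1 : LGConfig 4 (Matrix.specialUnitaryGroup (Fin 2) ℂ)) ≤ β ^ (2 * δ - 1) := by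
  intro y _ i j _
  rw [two_sub_plane_eq_plaqCostAt (i, j) y]
  have h0 : plaqCostAt (fundamentalRep (Fin 2)) y i j (1 : LGConfig 4 (Matrix.specialUnitaryGroup (Fin 2) ℂ)) = 0 := by
    simp only [plaqCostAt, plaquetteObs, plaquetteHolonomyZd, Pi.one_apply, mul_one, inv_one, map_one, Matrix.trace_one,
      Fintype.card_fin, Complex.natCast_re]
    norm_num
  rw [h0]
  exact Real.rpow_nonneg hβ _

/-! ### §3 The theorems: two corona-good exteriors, the cold wall, and the literal (CW) inequality — at the top of the polynomial window -/

/-- **TWO CORONA-GOOD EXTERIORS HAVE THE SAME CENTRE KERNEL MEAN TO `o(R⁻⁴)` AT THE TOP OF THE POLYNOMIAL WINDOW (crux letters).**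
There is `θ₀ ∈ (0, 1/100]` such that for all `0 < θ ≤ θ₀` there is `β₂ > 0` with: for all `β ≥ β₂`, all `R` with `R + 1 = ⌈β^θ⌉`, every plane
`q.1 < q.2`, every site `x`, and all exteriors `η, η'` each of whose plaquettes based in the corona range `[x − R − 2, x + R + 2]⁴` of the cube
`(x − R − 1, 2R + 3)` has deficit `2 − plane ≤ β^{2θ/5 − 1}`:
`R⁴ · |kerE^η_{β,(x−R−1,2R+3)}(plane q x) − kerE^{η'}_{β,(x−R−1,2R+3)}(plane q x)| ≤ β^{−1/2}`. [folklore] -/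
theorem kerE_sub_kerE_le_of_coronaGood_polyTop :
    ∃ θ₀ : ℝ, 0 < θ₀ ∧ θ₀ ≤ 1 / 100 ∧ ∀ θ : ℝ, 0 < θ → θ ≤ θ₀ → ∃ β₂ : ℝ, 0 < β₂ ∧ ∀ β : ℝ, β₂ ≤ β →
      ∀ R : ℕ, R + 1 = ⌈β ^ θ⌉₊ → ∀ (q : Fin 4 × Fin 4) (x : Fin 4 → ℤ), q.1 < q.2 →
      ∀ η η' : LGConfig 4 (Matrix.specialUnitaryGroup (Fin 2) ℂ),
        (∀ y : Fin 4 → ℤ, (∀ k : Fin 4, x k - R - 2 ≤ y k ∧ y k ≤ x k + R + 2) → ∀ i j : Fin 4, i < j →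
          2 - plane (Matrix.specialUnitaryGroup (Fin 2) ℂ) (fundamentalLatticeRep 2) (i, j) y η ≤ β ^ (2 * (θ / 5) - 1)) →
        (∀ y : Fin 4 → ℤ, (∀ k : Fin 4, x k - R - 2 ≤ y k ∧ y k ≤ x k + R + 2) → ∀ i j : Fin 4, i < j →
          2 - plane (Matrix.specialUnitaryGroup (Fin 2) ℂ) (fundamentalLatticeRep 2) (i, j) y η' ≤ β ^ (2 * (θ / 5) - 1)) →
        (R : ℝ) ^ 4 * |kerE (Matrix.specialUnitaryGroup (Fin 2) ℂ) (fundamentalLatticeRep 2) β (fun k => x k - (R + 1)) (2 * R + 3) η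
              (plane (Matrix.specialUnitaryGroup (Fin 2) ℂ) (fundamentalLatticeRep 2) q x) -
            kerE (Matrix.specialUnitaryGroup (Fin 2) ℂ) (fundamentalLatticeRep 2) β (fun k => x k - (R + 1)) (2 * R + 3) η'
              (plane (Matrix.specialUnitaryGroup (Fin 2) ℂ) (fundamentalLatticeRep 2) q x)| ≤ β ^ (-(1 / 2 : ℝ)) := by
  obtain ⟨θ₀, hθ₀, hθ₀', hmain⟩ := kernelMean_sub_kernelMean_le_of_crudeGood
  refine ⟨θ₀, hθ₀, hθ₀', fun θ hθ hθle => ?_⟩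
  obtain ⟨β₀, hβ₀⟩ := hmain θ hθ hθle
  have hθ1 : θ ≤ 1 / 100 := hθle.trans hθ₀'
  -- numerics: `16 (2H+3)⁸ β^{2θ/5−1} ≤ ½β^{−1/2}` and `2 (2H+3)⁴ β^{−1−θ} ≤ ½β^{−1/2}`
  obtain ⟨b₁, hb₁1, E1⟩ := exists_const_mul_boxSide_pow_mul_rpow_le (32 : ℝ) 8 (θ := θ) (a := 2 * (θ / 5) - 1) (b := -(1 / 2 : ℝ)) hθ
    (by push_cast; linarith)
  obtain ⟨b₂, -, E2⟩ := exists_const_mul_boxSide_pow_mul_rpow_le (4 : ℝ) 4 (θ := θ) (a := -1 - θ) (b := -(1 / 2 : ℝ)) hθ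
    (by push_cast; linarith)
  refine ⟨max β₀ (max b₁ b₂), lt_of_lt_of_le one_pos (hb₁1.trans ((le_max_left _ _).trans (le_max_right _ _))),
    fun β hβ R hR q x hq η η' hη hη' => ?_⟩
  have hb0 : β₀ ≤ β := (le_max_left _ _).trans hβ
  have hb1 : b₁ ≤ β := le_trans (le_trans (le_max_left _ _) (le_max_right _ _)) hβ
  have hb2 : b₂ ≤ β := le_trans (le_trans (le_max_right _ _) (le_max_right _ _)) hβ
  -- a coordinate permutation onto the plane `q`
  obtain ⟨σ, h1, h2⟩ := exists_perm_one_two (ne_of_lt hq)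
  -- the two exteriors, moved to the origin cube and the `(1,2)`-plane, are crude-good data of the box `⌈β^θ⌉`
  have hg : CrudeGood β (θ / 5) ⌈β ^ θ⌉₊ ((relabelConfig (edgePerm σ)).symm (configShift (fun k => ((R : ℤ) + 1) - x k) η)) := by
    rw [relabelConfig_edgePerm_symm_apply, ← hR]
    exact crudeGood_relabel_edgePerm σ.symm (crudeGood_configShift_of_coronaGood hη)
  have hg' : CrudeGood β (θ / 5) ⌈β ^ θ⌉₊ ((relabelConfig (edgePerm σ)).symm (configShift (fun k => ((R : ℤ) + 1) - x k) η')) := by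
    rw [relabelConfig_edgePerm_symm_apply, ← hR]
    exact crudeGood_relabel_edgePerm σ.symm (crudeGood_configShift_of_coronaGood hη')
  have hcast : ((⌈β ^ θ⌉₊ : ℕ) : ℤ) = (R : ℤ) + 1 := by rw [← hR]; push_cast; ring
  have hcentre : ∀ m : Fin 4, 8 * |(fun _ : Fin 4 => (R : ℤ) + 1) m - (⌈β ^ θ⌉₊ : ℤ)| ≤ (⌈β ^ θ⌉₊ : ℤ) := fun m => by
    rw [hcast]; simp only [sub_self, abs_zero, mul_zero]; positivity
  have hm := hβ₀ β hb0 _ _ hg hg' (fun _ => (R : ℤ) + 1) hcentre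
  -- rewrite the crux kernels as the route's kernel means at the centre
  rw [kerE_plane_eq_origin_perm β R q x η σ h1 h2, kerE_plane_eq_origin_perm β R q x η' σ h1 h2, kerE_plane_centre_eq,
    kerE_plane_centre_eq, hR]
  rw [show ∀ a b : ℝ, (2 - a) - (2 - b) = b - a from fun a b => by ring, abs_sub_comm]
  -- arithmetic
  set S : ℝ := 2 * (⌈β ^ θ⌉₊ : ℝ) + 3 with hS
  have hRS : (R : ℝ) ≤ S := by
    have h : (R : ℝ) + 1 = (⌈β ^ θ⌉₊ : ℝ) := by exact_mod_cast hR
    rw [hS]; linarith [(Nat.cast_nonneg R : (0 : ℝ) ≤ R)]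
  have hR4 : (R : ℝ) ^ 4 ≤ S ^ 4 := pow_le_pow_left₀ (Nat.cast_nonneg R) hRS 4
  generalize hDdef : |(∫ U, plaqCostAt (fundamentalRep (Fin 2)) (fun _ => (R : ℤ) + 1) 1 2 U
      ∂boxKernel β ⌈β ^ θ⌉₊ ((relabelConfig (edgePerm σ)).symm (configShift (fun k => ((R : ℤ) + 1) - x k) η))) -
      ∫ U, plaqCostAt (fundamentalRep (Fin 2)) (fun _ => (R : ℤ) + 1) 1 2 U
      ∂boxKernel β ⌈β ^ θ⌉₊ ((relabelConfig (edgePerm σ)).symm (configShift (fun k => ((R : ℤ) + 1) - x k) η'))| = D at hm ⊢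
  have hβ0 : 0 ≤ β := le_trans (by linarith [hb₁1]) hb1
  have hS0 : 0 ≤ S := by rw [hS]; positivity
  have hpos1 : 0 ≤ 16 * S ^ 4 * β ^ (2 * (θ / 5) - 1) + 2 * β ^ (-1 - θ) :=
    add_nonneg (mul_nonneg (mul_nonneg (by norm_num) (pow_nonneg hS0 4)) (Real.rpow_nonneg hβ0 _))
      (mul_nonneg (by norm_num) (Real.rpow_nonneg hβ0 _))
  calc (R : ℝ) ^ 4 * D ≤ (R : ℝ) ^ 4 * (16 * S ^ 4 * β ^ (2 * (θ / 5) - 1) + 2 * β ^ (-1 - θ)) :=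
        mul_le_mul_of_nonneg_left hm (pow_nonneg (Nat.cast_nonneg R) 4)
    _ ≤ S ^ 4 * (16 * S ^ 4 * β ^ (2 * (θ / 5) - 1) + 2 * β ^ (-1 - θ)) := mul_le_mul_of_nonneg_right hR4 hpos1
    _ = 1 / 2 * (32 * S ^ 8 * β ^ (2 * (θ / 5) - 1)) + 1 / 2 * (4 * S ^ 4 * β ^ (-1 - θ)) := by ring
    _ ≤ β ^ (-(1 / 2 : ℝ)) := by linarith [E1 β hb1, E2 β hb2]

/-- **THE NEAR-FLAT CORNER OF (CW): CORONA-GOOD EXTERIORS vs THE COLD WALL, carrier-free, at the top of the polynomial window.**  There is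
`θ₀ ∈ (0, 1/100]` such that for all `0 < θ ≤ θ₀` there is `β₂ > 0` with: for all `β ≥ β₂`, all `R` with `R + 1 = ⌈β^θ⌉`, every plane `q.1 < q.2`,
every site `x` and every exterior `η` each of whose plaquettes based in the corona range `[x − R − 2, x + R + 2]⁴` has deficit `≤ β^{2θ/5−1}`:
`R⁴ · |kerE^η_{β,(x−R−1,2R+3)}(plane q x) − kerE^𝟙_{β,(x−R−1,2R+3)}(plane q x)| ≤ β^{−1/2}` — the inequality of the registered stub
`stub_coldWallSplit` there, WITHOUT the carrier term. [folklore] -/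
theorem coldWallSplit_coronaGood_polyTop :
    ∃ θ₀ : ℝ, 0 < θ₀ ∧ θ₀ ≤ 1 / 100 ∧ ∀ θ : ℝ, 0 < θ → θ ≤ θ₀ → ∃ β₂ : ℝ, 0 < β₂ ∧ ∀ β : ℝ, β₂ ≤ β →
      ∀ R : ℕ, R + 1 = ⌈β ^ θ⌉₊ → ∀ (q : Fin 4 × Fin 4) (x : Fin 4 → ℤ), q.1 < q.2 →
      ∀ η : LGConfig 4 (Matrix.specialUnitaryGroup (Fin 2) ℂ),
        (∀ y : Fin 4 → ℤ, (∀ k : Fin 4, x k - R - 2 ≤ y k ∧ y k ≤ x k + R + 2) → ∀ i j : Fin 4, i < j →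
          2 - plane (Matrix.specialUnitaryGroup (Fin 2) ℂ) (fundamentalLatticeRep 2) (i, j) y η ≤ β ^ (2 * (θ / 5) - 1)) →
        (R : ℝ) ^ 4 * |kerE (Matrix.specialUnitaryGroup (Fin 2) ℂ) (fundamentalLatticeRep 2) β (fun k => x k - (R + 1)) (2 * R + 3) η
              (plane (Matrix.specialUnitaryGroup (Fin 2) ℂ) (fundamentalLatticeRep 2) q x) -
            kerE (Matrix.specialUnitaryGroup (Fin 2) ℂ) (fundamentalLatticeRep 2) β (fun k => x k - (R + 1)) (2 * R + 3) 1
              (plane (Matrix.specialUnitaryGroup (Fin 2) ℂ) (fundamentalLatticeRep 2) q x)| ≤ β ^ (-(1 / 2 : ℝ)) := by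
  obtain ⟨θ₀, hθ₀, hθ₀', hmain⟩ := kerE_sub_kerE_le_of_coronaGood_polyTop
  refine ⟨θ₀, hθ₀, hθ₀', fun θ hθ hθle => ?_⟩
  obtain ⟨β₂, hβ₂, h⟩ := hmain θ hθ hθle
  refine ⟨β₂, hβ₂, fun β hβ R hR q x hq η hη => ?_⟩
  exact h β hβ R hR q x hq η 1 hη (coronaGood_one (hβ₂.le.trans hβ) R x)

/-- **THE LITERAL (CW) INEQUALITY FOR CORONA-GOOD EXTERIORS AT THE TOP OF THE POLYNOMIAL WINDOW, WITH ANY CONSTANTS.**  For the `θ₀` above,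
all `0 < θ ≤ θ₀` and ANY `C_s, C₁, A₂ > 0` there is `β₂` with: for all `β ≥ β₂`, `R + 1 = ⌈β^θ⌉`, `q.1 < q.2`, `x`, and every corona-good `η`,
`(R⁴/C₁)·|kerE^η(plane q x) − kerE^𝟙(plane q x)| ≤ A₂ + carrierCl rF C_s 1 β R q x η` — the sentence of `stub_coldWallSplit` restricted to
this scale and these exteriors (the carrier is only used through `carrierCl ≥ 0`: near-flat exteriors need no classical payment). [folklore] -/
theorem coldWallSplit_inequality_coronaGood_polyTop :
    ∃ θ₀ : ℝ, 0 < θ₀ ∧ θ₀ ≤ 1 / 100 ∧ ∀ θ : ℝ, 0 < θ → θ ≤ θ₀ → ∀ C_s C₁ A₂ : ℝ, 0 < C_s → 0 < C₁ → 0 < A₂ →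
      ∃ β₂ : ℝ, 0 < β₂ ∧ ∀ β : ℝ, β₂ ≤ β →
      ∀ R : ℕ, R + 1 = ⌈β ^ θ⌉₊ → ∀ (q : Fin 4 × Fin 4) (x : Fin 4 → ℤ), q.1 < q.2 →
      ∀ η : LGConfig 4 (Matrix.specialUnitaryGroup (Fin 2) ℂ),
        (∀ y : Fin 4 → ℤ, (∀ k : Fin 4, x k - R - 2 ≤ y k ∧ y k ≤ x k + R + 2) → ∀ i j : Fin 4, i < j →
          2 - plane (Matrix.specialUnitaryGroup (Fin 2) ℂ) (fundamentalLatticeRep 2) (i, j) y η ≤ β ^ (2 * (θ / 5) - 1)) →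
        (R : ℝ) ^ 4 / C₁ * |kerE (Matrix.specialUnitaryGroup (Fin 2) ℂ) (fundamentalLatticeRep 2) β (fun k => x k - (R + 1)) (2 * R + 3) η
              (plane (Matrix.specialUnitaryGroup (Fin 2) ℂ) (fundamentalLatticeRep 2) q x) -
            kerE (Matrix.specialUnitaryGroup (Fin 2) ℂ) (fundamentalLatticeRep 2) β (fun k => x k - (R + 1)) (2 * R + 3) 1
              (plane (Matrix.specialUnitaryGroup (Fin 2) ℂ) (fundamentalLatticeRep 2) q x)| ≤
          A₂ + carrierCl (fundamentalLatticeRep 2) C_s 1 β R q x η := by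
  obtain ⟨θ₀, hθ₀, hθ₀', hmain⟩ := coldWallSplit_coronaGood_polyTop
  refine ⟨θ₀, hθ₀, hθ₀', fun θ hθ hθle C_s C₁ A₂ hCs hC₁ hA₂ => ?_⟩
  obtain ⟨β₂, hβ₂, h⟩ := hmain θ hθ hθle
  -- eventually `β^{−1/2} ≤ A₂ C₁`
  obtain ⟨b, hb1, hb⟩ := exists_const_mul_rpow_le_rpow (1 / (A₂ * C₁)) (a := -(1 / 2 : ℝ)) (b := 0) (by norm_num)
  refine ⟨max β₂ b, lt_of_lt_of_le hβ₂ (le_max_left _ _), fun β hβ R hR q x hq η hη => ?_⟩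
  have hβ2 : β₂ ≤ β := (le_max_left _ _).trans hβ
  have hbβ : b ≤ β := (le_max_right _ _).trans hβ
  have hβ0 : 0 ≤ β := hβ₂.le.trans hβ2
  have hmainβ := h β hβ2 R hR q x hq η hη
  have hsmall : β ^ (-(1 / 2 : ℝ)) ≤ A₂ * C₁ := by
    have h1 := hb β hbβ
    rw [Real.rpow_zero, one_div, inv_mul_le_iff₀ (mul_pos hA₂ hC₁), mul_one] at h1; exact h1
  have hcar : 0 ≤ carrierCl (fundamentalLatticeRep 2) C_s 1 β R q x η := carrierCl_nonneg hCs one_pos hβ0 R q x η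
  generalize hDdef : |kerE (Matrix.specialUnitaryGroup (Fin 2) ℂ) (fundamentalLatticeRep 2) β (fun k => x k - (R + 1)) (2 * R + 3) η
              (plane (Matrix.specialUnitaryGroup (Fin 2) ℂ) (fundamentalLatticeRep 2) q x) -
            kerE (Matrix.specialUnitaryGroup (Fin 2) ℂ) (fundamentalLatticeRep 2) β (fun k => x k - (R + 1)) (2 * R + 3) 1
              (plane (Matrix.specialUnitaryGroup (Fin 2) ℂ) (fundamentalLatticeRep 2) q x)| = D at hmainβ ⊢
  rw [div_mul_eq_mul_div, div_le_iff₀ hC₁]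
  nlinarith [hmainβ, hsmall, hcar, hC₁]

end Summit.QuantumFields.YangMills.Cruxes.UVSeamRec.ClassicalResponse.ColdWall

end
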